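import Literature.NumberTheory.EllipticCurves.FunctionFieldPlaces
import Mathlib.RingTheory.Valuation.Integers
import Mathlib.RingTheory.Valuation.Integral
import Mathlib.RingTheory.DedekindDomain.IntegralClosure
import Mathlib.NumberTheory.RamificationInertia.Basic
import Mathlib.FieldTheory.IntermediateField.Adjoin.Algebra
import Mathlib.RingTheory.Algebraic.Basic
import Mathlib.FieldTheory.SeparablyGenerated
import Mathlib.FieldTheory.PurelyInseparable.Exponent
import Mathlib.RingTheory.AlgebraicIndependent.TranscendenceBasis
import Mathlib.FieldTheory.Finite.Basic
import Mathlib.FieldTheory.RatFunc.AsPolynomial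

/-!
# Degree of principal divisors of a global function field (proofs)

Discharge of the named fact `Literature.NumberTheory.EllipticCurves.FunctionField.finsum_ord_mul_degree_eq_zero` of
`Literature.NumberTheory.EllipticCurves.FunctionFieldPlaces`: for `x ≠ 0` in a global function
field `F / 𝔽_q(T)`, `∑_v ord_v(x) · deg v = 0` (Rosen, *Number Theory in Function Fields*,
Prop. 5.1: `deg (x)_0 = deg (x)_∞ = [F : 𝔽_q(x)]`; Stichtenoth Thm. I.4.11).

## Proof architecture (Rosen, Prop. 5.1 with Ch. 7)

1. `Place.ord` API from the definition (`ord_mul`, `ord_inv`, `ord_pow`, sign of `ord` versus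
   membership in `O_v`, comparison with normalised `ℤᵐ⁰`-valuations).
2. Places attached to height-one primes `P` of a Dedekind domain `S` with fraction field `F`:
   the localisation `S_P` is the valuation ring of a place
   (`Place.exists_val_eq_valuationSubringAtPrime`), whose residue field is `S ⧸ P` and whose
   `ord` on `S` counts `P` in factorisations; conversely a place `v` containing `S` lies over
   the prime `m_v ∩ S`, and `O_v = S_{m_v ∩ S}` (a DVR is a maximal subring, Rosen Lemma 7.3;
   `Place.val_eq_valuationSubringAtPrime_comap`).
3. Glue (Rosen Ch. 7, proof of Thm. 7.6): if every zero of `x` contains `S ⊇ R ∋ x` (`S` finite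
   Dedekind over `R`, `(x)` maximal in `R` with residue field of size `q`), the zeros of `x` are the
   primes of `S` over `(x)` with `ord = e`, `deg = f`, so `∑_{ord_v x > 0} ord_v(x) deg v = ∑ e f`.
4. Separable chart: for `x` transcendental over `𝔽_q` with `F / 𝔽_q(x)` finite separable,
   `R = 𝔽_q[x]`, `S` its integral closure, Mathlib's fundamental identity
   `Ideal.sum_ramification_inertia` gives `∑_{ord_v x > 0} ord_v(x) deg v = [F : 𝔽_q(x)]`
   (Rosen Thm. 7.6 / Prop. 5.1, `deg (x)_0 = [F : 𝔽_q(x)]`).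
5. Field theory (section `FieldTheory`; Rosen Prop. 7.4 with its Corollary and Prop. 7.5,
   Stichtenoth Prop. III.10.2):
   `[F : 𝔽_q(x)] < ∞` for transcendental `x`; `[F : Fᵖ] ≤ p` via a separating transcendence basis
   (Mathlib `exists_isTranscendenceBasis_and_isSeparable_of_perfectField`); `x ∉ Fᵖ ⇒ F / 𝔽_q(x)`
   separable; hence every transcendental `x` is `y ^ (p ^ e)` with `F / 𝔽_q(y)` separable.
6. Assembly: zeros and poles (zeros of `y⁻¹`) of a separable `y` both count `[F : 𝔽_q(y)]`;
   `ord_v (y ^ n) = n ord_v y`; nonzero constants are roots of unity.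

## Design notes

* This file introduces no definitions: the place of a height-one prime `P` is any place `w`
  with `w.1 = valuationSubringAtPrime F P` (hypothesis `hw` of the lemmas in section `Dedekind`;
  existence in `Place.exists_val_eq_valuationSubringAtPrime`), and the prime under a place `v`
  containing `S` is written out as `Ideal.comap ((algebraMap S F).codRestrict v.1 hS) m_v`.
* The constant field acts on `F` only through `[Algebra Fq[X] F]` in `FunctionFieldPlaces`; the
  final proof installs `Algebra Fq F := (algebraMap Fq[X] F).comp C` locally and checks the scalar
  tower with `RatFunc Fq`. All intermediate results are stated for an abstract `[Algebra Fq F]`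
  with `Algebra.EssFiniteType Fq F` and `Algebra.trdeg Fq F = 1` (Rosen's "function field in one
  variable", Ch. 5, p. 49), supplied by `essFiniteType_of_ratFunc` / `trdeg_eq_one_of_ratFunc`.
* `Place.degree` is taken over `𝔽_q` (not over the exact constant field), as in the fact.

## References

* M. Rosen, *Number Theory in Function Fields*, GTM 210, Springer 2002: Ch. 5, p. 49 and
  Prop. 5.1 (p. 51); Ch. 7, Prop. 7.2, Lemma 7.3, Prop. 7.4 and Corollary, Prop. 7.5, Thm. 7.6
  (pp. 84–87). [RosenFunctionFields2002]
* H. Stichtenoth, *Algebraic Function Fields and Codes*, GTM 254, Thm. I.4.11, Prop. III.10.2.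
  [Stichtenoth2009]
-/

noncomputable section

open scoped Classical WithZero

open WithZero

namespace Literature.NumberTheory.EllipticCurves.FunctionField

namespace Place

variable {F : Type} [Field F] (v : Place F)

open IsDiscreteValuationRing

/-- Unfolding `ord_v` on `O_v`: for `x ∈ O_v`, `ord_v x` is the additive valuation of `x`, as an
integer. [folklore] -/
theorem ord_of_mem {x : F} (hx : x ∈ v.1) :
    v.ord x = ((addVal v.1 ⟨x, hx⟩).toNat : ℤ) := by
  simp only [ord, dif_pos hx]

/-- Unfolding `ord_v` off `O_v`: for `x ∉ O_v`, `ord_v x = -addVal (x⁻¹)`. [folklore] -/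
theorem ord_of_not_mem {x : F} (hx : x ∉ v.1) :
    v.ord x = -((addVal v.1 ⟨x⁻¹, (v.1.mem_or_inv_mem x).resolve_left hx⟩).toNat : ℤ) := by
  simp only [ord, dif_neg hx]

/-- The junk value `ord_v 0 = 0`. [folklore] -/
@[simp] theorem ord_zero : v.ord 0 = 0 := by
  rw [ord_of_mem v (zero_mem _)]
  have : (⟨(0 : F), zero_mem _⟩ : v.1) = 0 := rfl
  simp [this]

/-- `ord_v` of an element of `O_v` is its additive valuation. [folklore] -/
theorem ord_coe (x : v.1) : v.ord (x : F) = ((addVal v.1 x).toNat : ℤ) := by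
  rw [ord_of_mem v x.2]

/-- The inverse of a unit of `O_v`, computed in `F`. [folklore] -/
theorem coe_unit_inv (u : (v.1)ˣ) : (((u⁻¹ : (v.1)ˣ) : v.1) : F) = (((u : v.1) : F))⁻¹ := by
  apply eq_inv_of_mul_eq_one_left
  have h : ((u⁻¹ : (v.1)ˣ) : v.1) * (u : v.1) = 1 := Units.inv_mul u
  have := congrArg Subtype.val h
  push_cast at this
  exact this

/-- `ord_v (u ϖⁿ) = n` for `n : ℕ`. [folklore] -/
theorem ord_unit_mul_pow {ϖ : v.1} (hϖ : Irreducible ϖ) (u : (v.1)ˣ) (n : ℕ) :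
    v.ord (((u : v.1) : F) * (ϖ : F) ^ n) = n := by
  have : ((u : v.1) : F) * (ϖ : F) ^ n = (((u : v.1) * ϖ ^ n : v.1) : F) := by push_cast; rfl
  rw [this, ord_coe, addVal_def' u hϖ n]
  simp

/-- `u ϖ⁻ⁿ ∉ O_v` for `n > 0`. [folklore] -/
theorem unit_mul_pow_inv_not_mem {ϖ : v.1} (hϖ : Irreducible ϖ) (u : (v.1)ˣ) {n : ℕ} (hn : 0 < n) :
    ((u : v.1) : F) * ((ϖ : F) ^ n)⁻¹ ∉ v.1 := by
  intro hmem
  have hϖ0 : (ϖ : F) ≠ 0 := hϖ.coe_ne_zero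
  -- in `O_v`: `ϖ ^ n * y = u`, so `ϖ` divides a unit
  set y : v.1 := ⟨_, hmem⟩ with hy
  have hyu : ϖ ^ n * y = (u : v.1) := by
    apply Subtype.ext
    change (↑(ϖ ^ n) : F) * (((u : v.1) : F) * ((ϖ : F) ^ n)⁻¹) = ((u : v.1) : F)
    push_cast
    field_simp
  have hunit : IsUnit (ϖ ^ n) := isUnit_of_mul_isUnit_left (hyu ▸ Units.isUnit u)
  rw [isUnit_pow_iff hn.ne'] at hunit
  exact hϖ.not_isUnit hunit

/-- `ord_v (u ϖ⁻ⁿ) = -n` for `n : ℕ`, `n > 0`. [folklore] -/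
theorem ord_unit_mul_pow_inv {ϖ : v.1} (hϖ : Irreducible ϖ) (u : (v.1)ˣ) {n : ℕ} (hn : 0 < n) :
    v.ord (((u : v.1) : F) * ((ϖ : F) ^ n)⁻¹) = -n := by
  have hϖ0 : (ϖ : F) ≠ 0 := hϖ.coe_ne_zero
  have hnot := v.unit_mul_pow_inv_not_mem hϖ u hn
  rw [ord_of_not_mem v hnot]
  have hu0 : ((u : v.1) : F) ≠ 0 := by
    have : (u : v.1) ≠ 0 := u.ne_zero
    exact_mod_cast this
  have : (⟨(((u : v.1) : F) * ((ϖ : F) ^ n)⁻¹)⁻¹, (v.1.mem_or_inv_mem _).resolve_left hnot⟩ : v.1) =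
      ((u⁻¹ : (v.1)ˣ) : v.1) * ϖ ^ n := by
    apply Subtype.ext
    push_cast
    rw [mul_inv, inv_inv, coe_unit_inv]
  rw [this, addVal_def' u⁻¹ hϖ n]
  simp

/-- `ord_v (u ϖⁿ) = n` for `n : ℤ`. [folklore] -/
theorem ord_unit_mul_zpow {ϖ : v.1} (hϖ : Irreducible ϖ) (u : (v.1)ˣ) (n : ℤ) :
    v.ord (((u : v.1) : F) * (ϖ : F) ^ n) = n := by
  rcases Int.eq_nat_or_neg n with ⟨m, rfl | rfl⟩
  · rw [zpow_natCast, ord_unit_mul_pow v hϖ u m]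
  · rcases Nat.eq_zero_or_pos m with rfl | hm
    · simpa using ord_unit_mul_pow v hϖ u 0
    · rw [zpow_neg, zpow_natCast, ord_unit_mul_pow_inv v hϖ u hm]

/-- Every `x ≠ 0` is `u ϖⁿ` for a unit `u ∈ O_vˣ` and `n : ℤ`. [folklore] -/
theorem exists_eq_unit_mul_zpow {ϖ : v.1} (hϖ : Irreducible ϖ) {x : F} (hx : x ≠ 0) :
    ∃ (u : (v.1)ˣ) (n : ℤ), x = ((u : v.1) : F) * (ϖ : F) ^ n := by
  by_cases hmem : x ∈ v.1
  · have hx' : (⟨x, hmem⟩ : v.1) ≠ 0 := fun h => hx (congrArg Subtype.val h)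
    obtain ⟨n, u, hu⟩ := eq_unit_mul_pow_irreducible hx' hϖ
    refine ⟨u, n, ?_⟩
    have := congrArg Subtype.val hu
    simpa using this
  · have hmem' : x⁻¹ ∈ v.1 := (v.1.mem_or_inv_mem x).resolve_left hmem
    have hx' : (⟨x⁻¹, hmem'⟩ : v.1) ≠ 0 := fun h => inv_ne_zero hx (congrArg Subtype.val h)
    obtain ⟨n, u, hu⟩ := eq_unit_mul_pow_irreducible hx' hϖ
    refine ⟨u⁻¹, -n, ?_⟩
    have := congrArg Subtype.val hu
    push_cast at this
    rw [coe_unit_inv, ← inv_inv x, this, mul_inv, zpow_neg, zpow_natCast]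

/-- `ord_v (x y) = ord_v x + ord_v y` for `x, y ≠ 0`: `ord_v` is a valuation (Rosen Ch. 5;
Stichtenoth §I.1). [folklore] -/
theorem ord_mul {x y : F} (hx : x ≠ 0) (hy : y ≠ 0) : v.ord (x * y) = v.ord x + v.ord y := by
  obtain ⟨ϖ, hϖ⟩ := exists_irreducible v.1
  obtain ⟨u, m, rfl⟩ := v.exists_eq_unit_mul_zpow hϖ hx
  obtain ⟨w, n, rfl⟩ := v.exists_eq_unit_mul_zpow hϖ hy
  have hϖ0 : (ϖ : F) ≠ 0 := hϖ.coe_ne_zero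
  have : ((u : v.1) : F) * (ϖ : F) ^ m * (((w : v.1) : F) * (ϖ : F) ^ n) =
      (((u * w : (v.1)ˣ) : v.1) : F) * (ϖ : F) ^ (m + n) := by
    push_cast
    rw [zpow_add₀ hϖ0]
    ring
  rw [this, ord_unit_mul_zpow v hϖ, ord_unit_mul_zpow v hϖ, ord_unit_mul_zpow v hϖ]

/-- `ord_v (x⁻¹) = -ord_v x`. [folklore] -/
@[simp] theorem ord_inv (x : F) : v.ord x⁻¹ = -v.ord x := by
  rcases eq_or_ne x 0 with rfl | hx
  · simp
  obtain ⟨ϖ, hϖ⟩ := exists_irreducible v.1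
  obtain ⟨u, m, rfl⟩ := v.exists_eq_unit_mul_zpow hϖ hx
  have : (((u : v.1) : F) * (ϖ : F) ^ m)⁻¹ = (((u⁻¹ : (v.1)ˣ) : v.1) : F) * (ϖ : F) ^ (-m) := by
    rw [coe_unit_inv, mul_inv, zpow_neg]
  rw [this, ord_unit_mul_zpow v hϖ, ord_unit_mul_zpow v hϖ]

/-- `ord_v 1 = 0`. [folklore] -/
@[simp] theorem ord_one : v.ord 1 = 0 := by
  obtain ⟨ϖ, hϖ⟩ := exists_irreducible v.1
  simpa using ord_unit_mul_zpow v hϖ 1 0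

/-- `ord_v (xⁿ) = n · ord_v x`. [folklore] -/
theorem ord_pow (x : F) (n : ℕ) : v.ord (x ^ n) = n * v.ord x := by
  induction n with
  | zero => simp
  | succ n ih =>
    rcases eq_or_ne x 0 with rfl | hx
    · simp
    rw [pow_succ, v.ord_mul (pow_ne_zero n hx) hx, ih]
    push_cast
    ring

/-- Roots of unity (in particular nonzero constants of a global function field) have `ord_v = 0`
at every place. [folklore] -/
theorem ord_eq_zero_of_pow_eq_one {x : F} {n : ℕ} (hn : 0 < n) (h : x ^ n = 1) : v.ord x = 0 := by
  have := v.ord_pow x n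
  rw [h, ord_one] at this
  rcases mul_eq_zero.mp this.symm with h1 | h1
  · exact absurd h1 (by exact_mod_cast hn.ne')
  · exact h1

/-- For `x ≠ 0`: `0 ≤ ord_v x ↔ x ∈ O_v`. [folklore] -/
theorem ord_nonneg_iff {x : F} (hx : x ≠ 0) : 0 ≤ v.ord x ↔ x ∈ v.1 := by
  obtain ⟨ϖ, hϖ⟩ := exists_irreducible v.1
  obtain ⟨u, m, rfl⟩ := v.exists_eq_unit_mul_zpow hϖ hx
  rw [ord_unit_mul_zpow v hϖ]
  constructor
  · intro hm
    lift m to ℕ using hm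
    rw [zpow_natCast]
    exact mul_mem (u : v.1).2 (pow_mem ϖ.2 m)
  · intro hmem
    by_contra hm
    push Not at hm
    obtain ⟨k, hk⟩ := Int.exists_eq_neg_ofNat (le_of_lt hm)
    have hk0 : 0 < k := by omega
    apply v.unit_mul_pow_inv_not_mem hϖ u hk0
    rwa [hk, zpow_neg, zpow_natCast] at hmem

/-- For `x ≠ 0`: `0 < ord_v x ↔ x ∈ m_v`, i.e. `x ∈ O_v` and `x⁻¹ ∉ O_v`. [folklore] -/
theorem ord_pos_iff {x : F} (hx : x ≠ 0) : 0 < v.ord x ↔ x⁻¹ ∉ v.1 := by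
  have h1 := v.ord_nonneg_iff (inv_ne_zero hx)
  rw [ord_inv] at h1
  constructor
  · intro h hmem
    have := h1.mpr hmem
    omega
  · intro hmem
    by_contra h
    exact hmem (h1.mp (by omega))

/-- `ord_v x = 0 ↔ x ∈ O_vˣ` (for `x ≠ 0`). [folklore] -/
theorem ord_eq_zero_iff {x : F} (hx : x ≠ 0) : v.ord x = 0 ↔ x ∈ v.1 ∧ x⁻¹ ∈ v.1 := by
  have h1 := v.ord_nonneg_iff hx
  have h2 := v.ord_nonneg_iff (inv_ne_zero hx)
  rw [ord_inv] at h2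
  constructor
  · intro h
    exact ⟨h1.mp h.ge, h2.mp (by omega)⟩
  · rintro ⟨ha, hb⟩
    have := h1.mpr ha
    have := h2.mpr hb
    omega

/-- On `O_v` the additive valuation is finite away from `0` and `ord_v` is its integer value.
[folklore] -/
theorem addVal_eq_ord (x : v.1) (hx : x ≠ 0) : addVal v.1 x = (v.ord (x : F)).toNat := by
  rw [ord_coe]
  have : addVal v.1 x ≠ ⊤ := by rwa [Ne, addVal_eq_top_iff]
  simp [ENat.coe_toNat this]

/-- For `x ∈ O_v`, `0 < ord_v x ↔ x ∈ m_v`. [folklore] -/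
theorem ord_pos_iff_mem_maximalIdeal (x : v.1) (hx : x ≠ 0) :
    0 < v.ord (x : F) ↔ x ∈ IsLocalRing.maximalIdeal v.1 := by
  rw [IsLocalRing.mem_maximalIdeal, mem_nonunits_iff, ← addVal_eq_zero_iff, addVal_eq_ord v x hx]
  have h0 : 0 ≤ v.ord (x : F) := (v.ord_nonneg_iff (by exact_mod_cast hx)).mpr x.2
  constructor
  · intro h h'
    have : (v.ord (x : F)).toNat = 0 := by exact_mod_cast h'
    omega
  · intro h
    by_contra h'
    apply h
    have : v.ord (x : F) = 0 := by omega
    simp [this]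


/-! ### Comparison with a normalised `ℤᵐ⁰`-valued valuation -/

/-- If `w` is a `ℤᵐ⁰`-valued valuation of `F` whose ring of integers is `O_v` and which takes the
value `exp (-1)` (i.e. is normalised), then `w = exp (-ord_v)` on `F^*`. [folklore] -/
theorem eq_exp_neg_ord_of_integers (w : Valuation F ℤᵐ⁰) (hw : w.Integers v.1)
    (hπ : ∃ π : F, w π = exp (-1 : ℤ)) {x : F} (hx : x ≠ 0) :
    w x = exp (-v.ord x) := by
  obtain ⟨ϖ, hϖ⟩ := exists_irreducible v.1
  have hϖ0 : (ϖ : F) ≠ 0 := hϖ.coe_ne_zero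
  -- `w ϖ = exp (-1)`
  have hwϖ : w (ϖ : F) = exp (-1 : ℤ) := by
    obtain ⟨π, hπ⟩ := hπ
    have hπ1 : w π ≤ 1 := by
      rw [hπ, ← exp_zero, exp_le_exp]; norm_num
    obtain ⟨π', rfl⟩ := hw.exists_of_le_one hπ1
    have hπ0 : π' ≠ 0 := by
      rintro rfl
      rw [map_zero, Valuation.map_zero] at hπ
      exact exp_ne_zero hπ.symm
    obtain ⟨n, u, rfl⟩ := eq_unit_mul_pow_irreducible hπ0 hϖ
    have hlt : w (ϖ : F) < 1 := hw.valuation_irreducible_lt_one hϖ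
    have hne : w (ϖ : F) ≠ 0 := (Valuation.ne_zero_iff w).2 hϖ0
    obtain ⟨a, ha⟩ : ∃ a : ℤ, w (ϖ : F) = exp a := ⟨log (w (ϖ : F)), (exp_log hne).symm⟩
    have hu : w (((u : v.1) : F)) = 1 := hw.valuation_unit u
    have h1 : w (algebraMap v.1 F ((u : v.1) * ϖ ^ n)) = exp a ^ n := by
      change w (((u : v.1) : F) * (ϖ : F) ^ n) = _
      rw [map_mul, map_pow, hu, one_mul, ha]
    rw [hπ, ← exp_nsmul, exp_inj] at h1
    rw [ha, ← exp_zero, exp_lt_exp] at hlt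
    have hn : (n : ℤ) * a = -1 := by rw [nsmul_eq_mul] at h1; exact h1.symm
    have : a = -1 := by
      -- from `n * a = -1` with `a < 0`, `n ≥ 0`
      have hn' : (n : ℤ) * (-a) = 1 := by linarith
      have hna := Int.eq_one_of_mul_eq_one_left (by omega) hn'
      omega
    rw [ha, this]
  obtain ⟨u, k, rfl⟩ := v.exists_eq_unit_mul_zpow hϖ hx
  rw [ord_unit_mul_zpow v hϖ, map_mul, map_zpow₀, hwϖ, ← exp_zsmul, zsmul_eq_mul, mul_neg,
    mul_one, Int.cast_id]
  have hu : w (((u : v.1) : F)) = 1 := hw.valuation_unit u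
  rw [hu, one_mul]

/-- Under the hypotheses of `eq_exp_neg_ord_of_integers`: `0 < ord_v x ↔ w x < 1`. [folklore] -/
theorem ord_pos_iff_lt_one_of_integers (w : Valuation F ℤᵐ⁰) (hw : w.Integers v.1)
    (hπ : ∃ π : F, w π = exp (-1 : ℤ)) {x : F} (hx : x ≠ 0) :
    0 < v.ord x ↔ w x < 1 := by
  rw [v.eq_exp_neg_ord_of_integers w hw hπ hx, ← exp_zero, exp_lt_exp]
  omega


end Place

end Literature.NumberTheory.EllipticCurves.FunctionField

/-! ### Places attached to height-one primes of a Dedekind domain with fraction field `F`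

For a Dedekind domain `S` with fraction field `F` and a nonzero prime `P` of `S`, the localisation
`S_P ⊆ F` (Mathlib's `valuationSubringAtPrime`) is the valuation ring of a place of `F`
(`Place.exists_val_eq_valuationSubringAtPrime`); the lemmas below describe any place `w` with
`O_w = S_P` (hypothesis `hw`), so that this proofs file introduces no definitions. Conversely a
place `v` with `S ⊆ O_v` (hypothesis `hS`) lies over the prime
`m_v ∩ S = Ideal.comap (S → O_v) m_v` of `S`. -/

namespace Literature.NumberTheory.EllipticCurves.FunctionField

namespace Place

section Dedekind

open IsDedekindDomain IsDedekindDomain.HeightOneSpectrum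

variable {F : Type} [Field F]
variable {S : Type} [CommRing S] [IsDedekindDomain S] [Algebra S F] [IsFractionRing S F]

/-- The localisation `S_P ⊆ F = Frac S` at a nonzero prime `P` of a Dedekind domain `S`
(Mathlib's `valuationSubringAtPrime`) is a proper subring: the inverse of a uniformiser is not
in it. [folklore] -/
theorem valuationSubringAtPrime_ne_top (P : HeightOneSpectrum S) :
    valuationSubringAtPrime F P ≠ ⊤ := by
  intro htop
  obtain ⟨π, hπ⟩ := P.valuation_exists_uniformizer F
  have hmem : π⁻¹ ∈ valuationSubringAtPrime F P := htop ▸ Subring.mem_top _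
  rw [valuationSubringAtPrime_eq_valuationSubring, Valuation.mem_valuationSubring_iff,
    map_inv₀, hπ, ← exp_neg, ← exp_zero, exp_le_exp] at hmem
  norm_num at hmem

/-- **The place of a height-one prime.** For a nonzero prime `P` of a Dedekind domain `S` with
fraction field `F` there is a place `w` of `F` with valuation ring `O_w = S_P` (a DVR; Rosen
Ch. 5, proof of Prop. 5.1: "the localizations of `R` at the prime ideals `𝔓ᵢ` are primes of the
field `K`"). [folklore] -/
theorem exists_val_eq_valuationSubringAtPrime (P : HeightOneSpectrum S) :
    ∃ w : Place F, w.1 = valuationSubringAtPrime F P :=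
  ⟨⟨valuationSubringAtPrime F P, valuationSubringAtPrime_ne_top P,
    IsLocalization.AtPrime.isDiscreteValuationRing_of_dedekind_domain S P.ne_bot _⟩, rfl⟩

/-! #### Places whose valuation ring contains `S`: the prime `m_v ∩ S` -/

section Under

variable (v : Place F) (hS : ∀ s : S, algebraMap S F s ∈ v.1)

omit [IsDedekindDomain S] in
/-- For `S ⊆ O_v` and `s ∈ S ∖ {0}`: `s ∈ m_v ∩ S ↔ 0 < ord_v s`. [folklore] -/
theorem mem_comap_maximalIdeal_iff_ord_pos {s : S} (hs : s ≠ 0) :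
    s ∈ Ideal.comap ((algebraMap S F).codRestrict v.1 hS) (IsLocalRing.maximalIdeal v.1) ↔
      0 < v.ord (algebraMap S F s) := by
  have hs' : algebraMap S F s ≠ 0 := by simpa using hs
  rw [Ideal.mem_comap, IsLocalRing.mem_maximalIdeal, mem_nonunits_iff, v.ord_pos_iff hs']
  constructor
  · intro h hmem
    apply h
    exact isUnit_iff_exists_inv.2 ⟨⟨_, hmem⟩, Subtype.ext (mul_inv_cancel₀ hs')⟩
  · intro h hu
    apply h
    obtain ⟨y, hy⟩ := isUnit_iff_exists_inv.1 hu
    have : (algebraMap S F s)⁻¹ = (y : F) := by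
      have := congrArg Subtype.val hy
      exact (eq_inv_of_mul_eq_one_right this).symm ▸ rfl
    rw [this]; exact y.2

/-- If `S ⊆ O_v` and `m_v ∩ S = P ≠ 0`, then `O_v = S_P`: `S_P ≤ O_v`, and a DVR is a maximal
proper subring of its fraction field (Rosen, proof of Lemma 7.3; Mathlib's
`ValuationSubring.eq_of_le_of_ne_top`). [folklore] -/
theorem val_eq_valuationSubringAtPrime_comap
    (hne : Ideal.comap ((algebraMap S F).codRestrict v.1 hS) (IsLocalRing.maximalIdeal v.1) ≠ ⊥) :
    v.1 = valuationSubringAtPrime F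
      ⟨Ideal.comap ((algebraMap S F).codRestrict v.1 hS) (IsLocalRing.maximalIdeal v.1),
        inferInstance, hne⟩ := by
  symm
  refine ValuationSubring.eq_of_le_of_ne_top _ ?_ v.2.1
  rintro x ⟨a, s, hs, rfl⟩
  refine mul_mem (hS a) ?_
  have hsu : IsUnit (⟨algebraMap S F s, hS s⟩ : v.1) := by
    by_contra h
    exact hs h
  obtain ⟨y, hy⟩ := isUnit_iff_exists_inv.1 hsu
  have := congrArg Subtype.val hy
  have hinv : (algebraMap S F s)⁻¹ = (y : F) := (eq_inv_of_mul_eq_one_right this).symm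
  rw [hinv]; exact y.2

omit [IsDedekindDomain S] [IsFractionRing S F] in
/-- The prime `m_v ∩ S` does not depend on the proof of `S ⊆ O_v` and is compatible with equality
of places. [folklore] -/
theorem comap_maximalIdeal_congr {v w : Place F} (h : v = w) (hv : ∀ s : S, algebraMap S F s ∈ v.1)
    (hw : ∀ s : S, algebraMap S F s ∈ w.1) :
    Ideal.comap ((algebraMap S F).codRestrict v.1 hv) (IsLocalRing.maximalIdeal v.1) =
      Ideal.comap ((algebraMap S F).codRestrict w.1 hw) (IsLocalRing.maximalIdeal w.1) := by
  subst h; rfl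

end Under

/-! #### Places `w` with `O_w = S_P` -/

variable (P : HeightOneSpectrum S) {w : Place F} (hw : w.1 = valuationSubringAtPrime F P)

include hw

/-- If `O_w = S_P` then `x ∈ O_w ↔ |x|_P ≤ 1`. [folklore] -/
theorem mem_iff_valuation_le_one (x : F) : x ∈ w.1 ↔ P.valuation F x ≤ 1 := by
  rw [hw, valuationSubringAtPrime_eq_valuationSubring]
  rfl

/-- If `O_w = S_P` then `S ⊆ O_w`. [folklore] -/
theorem algebraMap_mem_of_val_eq (s : S) : algebraMap S F s ∈ w.1 :=
  (mem_iff_valuation_le_one P hw _).2 (P.valuation_le_one s)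

/-- If `O_w = S_P` then `O_w` is the ring of integers of the `P`-adic valuation. [folklore] -/
theorem integers_of_val_eq : (P.valuation F).Integers w.1 where
  hom_inj := Subtype.val_injective
  map_le_one x := (mem_iff_valuation_le_one P hw (x : F)).1 x.2
  exists_of_le_one x hx := ⟨⟨x, (mem_iff_valuation_le_one P hw x).2 hx⟩, rfl⟩

/-- If `O_w = S_P` then `|x|_P = exp (-ord_w x)` for `x ≠ 0`. [folklore] -/
theorem valuation_eq_exp_neg_ord_of_val_eq {x : F} (hx : x ≠ 0) :
    P.valuation F x = exp (-w.ord x) :=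
  w.eq_exp_neg_ord_of_integers _ (integers_of_val_eq P hw) (P.valuation_exists_uniformizer F) hx

/-- If `O_w = S_P` then `0 < ord_w x ↔ |x|_P < 1` for `x ≠ 0`. [folklore] -/
theorem ord_pos_iff_valuation_lt_one {x : F} (hx : x ≠ 0) : 0 < w.ord x ↔ P.valuation F x < 1 :=
  w.ord_pos_iff_lt_one_of_integers _ (integers_of_val_eq P hw)
    (P.valuation_exists_uniformizer F) hx

/-- If `O_w = S_P` then `ord_w s` for `s ∈ S ∖ {0}` is the multiplicity of `P` in `(s)`
(Rosen, proof of Prop. 5.1: `ord_{Pᵢ}(a) = eᵢ`). [folklore] -/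
theorem ord_algebraMap_eq_count {s : S} (hs : s ≠ 0) :
    w.ord (algebraMap S F s) =
      ((UniqueFactorizationMonoid.normalizedFactors (Ideal.span {s})).count P.asIdeal : ℕ) := by
  have h := valuation_eq_exp_neg_ord_of_val_eq P hw (x := algebraMap S F s) (by simpa using hs)
  rw [valuation_of_algebraMap, intValuation_if_neg _ hs, exp_inj, neg_inj,
    Ideal.count_associates_factors_eq (by simpa using hs) P.isPrime P.ne_bot] at h
  exact_mod_cast h.symm

/-- If `O_w = S_P` then `0 < ord_w s ↔ s ∈ P` for `s ∈ S ∖ {0}`. [folklore] -/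
theorem ord_algebraMap_pos_iff (s : S) (hs : s ≠ 0) :
    0 < w.ord (algebraMap S F s) ↔ s ∈ P.asIdeal := by
  rw [ord_pos_iff_valuation_lt_one P hw (by simpa using hs), valuation_of_algebraMap,
    intValuation_lt_one_iff_mem]

/-- If `O_w = S_P` then the maximal ideal `m_w` is cut out by `|·|_P < 1` (an integer is a unit
iff its valuation is `1`). [folklore] -/
theorem mem_maximalIdeal_iff_valuation_lt_one (x : w.1) :
    x ∈ IsLocalRing.maximalIdeal w.1 ↔ P.valuation F x < 1 := by
  rw [IsLocalRing.mem_maximalIdeal, mem_nonunits_iff,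
    (integers_of_val_eq P hw).isUnit_iff_valuation_eq_one]
  have := (integers_of_val_eq P hw).map_le_one x
  constructor
  · intro h; exact lt_of_le_of_ne this h
  · intro h; exact h.ne

/-- If `O_w = S_P` then the residue field `O_w / m_w` is `S ⧸ P`: the map `S → O_w → O_w / m_w`
is surjective with kernel `P`. [folklore] -/
theorem exists_residueField_equiv_quotient :
    Nonempty (IsLocalRing.ResidueField w.1 ≃+* S ⧸ P.asIdeal) := by
  let φ : S →+* w.1 := (algebraMap S F).codRestrict w.1 (algebraMap_mem_of_val_eq P hw)
  let f : S →+* IsLocalRing.ResidueField w.1 := (IsLocalRing.residue w.1).comp φ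
  have hf : Function.Surjective f := by
    intro r
    obtain ⟨a, rfl⟩ := IsLocalRing.residue_surjective r
    obtain ⟨s, hs⟩ :=
      P.exists_valuation_sub_lt_of_integer ((mem_iff_valuation_le_one P hw _).1 a.2) 1
    refine ⟨s, ?_⟩
    change IsLocalRing.residue w.1 (φ s) = IsLocalRing.residue w.1 a
    rw [← sub_eq_zero, ← map_sub, IsLocalRing.residue_eq_zero_iff,
      mem_maximalIdeal_iff_valuation_lt_one P hw]
    exact hs
  have hker : RingHom.ker f = P.asIdeal := by
    ext s
    rw [RingHom.mem_ker]
    change IsLocalRing.residue w.1 (φ s) = 0 ↔ _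
    rw [IsLocalRing.residue_eq_zero_iff, mem_maximalIdeal_iff_valuation_lt_one P hw]
    change P.valuation F (algebraMap S F s) < 1 ↔ _
    rw [valuation_of_algebraMap, intValuation_lt_one_iff_mem]
  exact ⟨(RingHom.quotientKerEquivOfSurjective hf).symm.trans (Ideal.quotEquivOfEq hker)⟩

/-- If `O_w = S_P` then `#(O_w / m_w) = #(S ⧸ P)`. [folklore] -/
theorem residueCard_eq_of_val_eq : w.residueCard = Nat.card (S ⧸ P.asIdeal) := by
  obtain ⟨e⟩ := exists_residueField_equiv_quotient P hw
  exact Nat.card_congr e.toEquiv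

/-- If `O_w = S_P` then `m_w ∩ S = P`. [folklore] -/
theorem comap_maximalIdeal_eq_of_val_eq :
    Ideal.comap ((algebraMap S F).codRestrict w.1 (algebraMap_mem_of_val_eq P hw))
      (IsLocalRing.maximalIdeal w.1) = P.asIdeal := by
  ext s
  rw [Ideal.mem_comap, mem_maximalIdeal_iff_valuation_lt_one P hw]
  change P.valuation F (algebraMap S F s) < 1 ↔ _
  rw [valuation_of_algebraMap, intValuation_lt_one_iff_mem]

end Dedekind

/-! ### Glue: zeros of `x` versus primes over `(x)`

Let `R → S ↪ L` with `S` a Dedekind domain, finite over `R`, with fraction field `L`, and let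
`p = (r)` be a nonzero maximal ideal of `R` with finite residue field of cardinality `q`, `x` the
image of `r` in `L`. If every place `v` of `L` with `ord_v x > 0` contains `S`, then these places
are exactly the places of the primes `P` of `S` over `p`, with `ord_v x = e(P/p)` and
`deg v = f(P/p)`; hence `∑_{ord_v x > 0} ord_v(x) · deg v = ∑_{P | p} e(P/p) f(P/p)`. -/

section Glue

open UniqueFactorizationMonoid

variable {L : Type} [Field L]
variable {R S : Type} [CommRing R] [IsDomain R] [CommRing S] [IsDedekindDomain S] [Algebra R S]
  [FaithfulSMul R S] [Module.Finite R S] [Algebra S L] [IsFractionRing S L] [Algebra R L]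
  [IsScalarTower R S L]

/-- **Glue lemma.** With notation as in the section docstring: the places with `ord_v x > 0` are
finitely many and `∑_{ord_v x > 0} ord_v(x) · deg v = ∑_{P | p} e(P/p) f(P/p)`.
[cite: RosenFunctionFields2002, Ch. 7, proof of Thm. 7.6 (primes above `P` ↔ places above `P`)] -/
theorem finite_zeros_and_finsum_eq_sum_ramification_inertia {q : ℕ} (hq : 1 < q)
    (p : Ideal R) [p.IsMaximal] (hp0 : p ≠ ⊥) (hcard : Nat.card (R ⧸ p) = q) {r : R}
    (hr : p = Ideal.span {r}) {x : L} (hx : algebraMap R L r = x)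
    (hzeros : ∀ v : Place L, 0 < v.ord x → ∀ s : S, algebraMap S L s ∈ v.1) :
    {v : Place L | 0 < v.ord x}.Finite ∧
      ∑ᶠ v ∈ {v : Place L | 0 < v.ord x}, v.ord x * (v.degree q : ℤ) =
        ∑ P ∈ IsDedekindDomain.primesOverFinset p S,
          Ideal.ramificationIdx' p P * Ideal.inertiaDeg' p P := by
  classical
  letI : Field (R ⧸ p) := Ideal.Quotient.field p
  have hinj : Function.Injective (algebraMap R S) := FaithfulSMul.algebraMap_injective R S
  have hr0 : r ≠ 0 := by
    rintro rfl
    exact hp0 (by rw [hr, Ideal.span_singleton_eq_bot])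
  set rS : S := algebraMap R S r with hrS
  have hrS0 : rS ≠ 0 := fun h => hr0 (hinj (by rw [← hrS, h, map_zero]))
  have hxS : algebraMap S L rS = x := by rw [hrS, ← IsScalarTower.algebraMap_apply, hx]
  have hmap : p.map (algebraMap R S) = Ideal.span {rS} := by
    rw [hr, Ideal.map_span, Set.image_singleton]
  have hmap0 : p.map (algebraMap R S) ≠ ⊥ := by
    rw [hmap, Ne, Ideal.span_singleton_eq_bot]; exact hrS0
  have hmem : ∀ P : Ideal S,
      P ∈ IsDedekindDomain.primesOverFinset p S ↔ P.IsPrime ∧ P.LiesOver p := fun P => by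
    rw [IsDedekindDomain.mem_primesOverFinset_iff hp0]; rfl
  -- the height-one primes of `S` over `p`, and their places
  obtain ⟨H, hH⟩ : ∃ H : {P // P ∈ IsDedekindDomain.primesOverFinset p S} →
      IsDedekindDomain.HeightOneSpectrum S, ∀ P, (H P).asIdeal = P.1 :=
    ⟨fun P => ⟨P.1, ((hmem P.1).1 P.2).1,
      haveI := ((hmem P.1).1 P.2).2
      Ideal.ne_bot_of_liesOver_of_ne_bot hp0 P.1⟩, fun _ => rfl⟩
  have hW' : ∀ P : {P // P ∈ IsDedekindDomain.primesOverFinset p S}, ∃ w : Place L,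
      w.1 = IsDedekindDomain.HeightOneSpectrum.valuationSubringAtPrime L (H P) := fun P =>
    exists_val_eq_valuationSubringAtPrime (H P)
  choose W hW using hW'
  -- ### `e(P/p) = ord_{v_P}(x)`
  have hord : ∀ P : {P // P ∈ IsDedekindDomain.primesOverFinset p S},
      ((W P).ord x : ℤ) = Ideal.ramificationIdx' p P.1 := by
    intro P
    rw [Ideal.IsDedekindDomain.ramificationIdx'_eq_normalizedFactors_count hmap0
      ((hmem P.1).1 P.2).1 (hH P ▸ (H P).ne_bot), hmap, ← hxS,
      ord_algebraMap_eq_count (H P) (hW P) hrS0, hH]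
  -- ### `f(P/p) = deg v_P`
  have hdeg : ∀ P : {P // P ∈ IsDedekindDomain.primesOverFinset p S},
      (W P).degree q = Ideal.inertiaDeg' p P.1 := by
    intro P
    haveI := ((hmem P.1).1 P.2).1
    haveI := ((hmem P.1).1 P.2).2
    rw [Ideal.inertiaDeg'_algebraMap, degree, residueCard_eq_of_val_eq (H P) (hW P), hH,
      Module.natCard_eq_pow_finrank (K := R ⧸ p), hcard, Nat.log_pow hq]
  -- ### every zero of `x` is some `v_P`
  have hsurj : ∀ v : Place L, 0 < v.ord x →
      ∃ P : {P // P ∈ IsDedekindDomain.primesOverFinset p S}, W P = v := by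
    intro v hv
    have hS := hzeros v hv
    set Q : Ideal S := Ideal.comap ((algebraMap S L).codRestrict v.1 hS)
      (IsLocalRing.maximalIdeal v.1) with hQ_def
    have hrQ : rS ∈ Q := by
      rw [hQ_def, mem_comap_maximalIdeal_iff_ord_pos v hS hrS0, hxS]; exact hv
    have hQ0 : Q ≠ ⊥ := fun h => hrS0 (by rw [h] at hrQ; exact hrQ)
    have hQp : Q.LiesOver p := by
      refine ⟨(Ideal.IsMaximal.eq_of_le inferInstance ?_ ?_)⟩
      · exact Ideal.comap_ne_top _ (Ideal.IsPrime.ne_top inferInstance)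
      · rw [hr, Ideal.span_singleton_le_iff_mem, Ideal.mem_comap]
        exact hrQ
    set Q' : {P // P ∈ IsDedekindDomain.primesOverFinset p S} :=
      ⟨Q, (hmem _).2 ⟨inferInstance, hQp⟩⟩
    have hHQ : H Q' = ⟨Q, inferInstance, hQ0⟩ := IsDedekindDomain.HeightOneSpectrum.ext (hH Q')
    refine ⟨Q', Subtype.ext ?_⟩
    rw [hW Q', hHQ]
    exact (val_eq_valuationSubringAtPrime_comap v hS hQ0).symm
  -- ### `P ↦ v_P` is injective
  have hinjW : Function.Injective W := by
    intro P₁ P₂ h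
    have e₁ := comap_maximalIdeal_eq_of_val_eq (H P₁) (hW P₁)
    have e₂ := comap_maximalIdeal_eq_of_val_eq (H P₂) (hW P₂)
    rw [hH] at e₁ e₂
    apply Subtype.ext
    rw [← e₁, ← e₂]
    exact comap_maximalIdeal_congr h _ _
  -- ### the finite set of zeros
  set T : Finset (Place L) := (IsDedekindDomain.primesOverFinset p S).attach.image W with hT
  have hTeq : (↑T : Set (Place L)) = {v : Place L | 0 < v.ord x} := by
    ext v
    simp only [hT, Finset.coe_image, Set.mem_image, Finset.mem_coe, Finset.mem_attach, true_and,
      Set.mem_setOf_eq]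
    constructor
    · rintro ⟨P, rfl⟩
      have h := hord P
      haveI := ((hmem P.1).1 P.2).1
      haveI := ((hmem P.1).1 P.2).2
      have hpos : 0 < Ideal.ramificationIdx' p P.1 :=
        Nat.pos_of_ne_zero (Ideal.IsDedekindDomain.ramificationIdx'_ne_zero_of_liesOver P.1 hp0)
      omega
    · intro hv
      exact hsurj v hv
  refine ⟨hTeq ▸ T.finite_toSet, ?_⟩
  rw [← hTeq, finsum_mem_coe_finset, hT, Finset.sum_image]
  · rw [← Finset.sum_attach (IsDedekindDomain.primesOverFinset p S)]
    push_cast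
    refine Finset.sum_congr rfl fun P _ => ?_
    rw [hord P, hdeg P]
  · rintro P₁ - P₂ - h
    exact hinjW h

end Glue

end Place

end Literature.NumberTheory.EllipticCurves.FunctionField

/-! ### Zeros of `x` counted with degree: the separable chart

For a field `L ⊇ 𝔽_q` and `x ∈ L` transcendental over `𝔽_q` with `L / 𝔽_q(x)` finite and
separable, the places `v` of `L` with `ord_v x > 0` are the primes of the integral closure `S` of
`𝔽_q[x]` in `L` lying over `(x)`, `ord_v x` is the ramification index and `deg v` the inertia
degree, so that `∑_{ord_v x > 0} ord_v(x) · deg v = [L : 𝔽_q(x)]` is Mathlib's fundamental identity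
`Ideal.sum_ramification_inertia` (Rosen, Prop. 5.1 with Thm. 7.6). -/

namespace Literature.NumberTheory.EllipticCurves.FunctionField

section ZerosCount

open IntermediateField algebraAdjoinAdjoin IsDedekindDomain Polynomial

variable {Fq : Type} [Field Fq] [Fintype Fq] {L : Type} [Field L] [Algebra Fq L]

/-- A valuation subring is the ring of integers of its own valuation. [folklore] -/
theorem valuationSubring_integers_self {K : Type} [Field K] (A : ValuationSubring K) :
    A.valuation.Integers A where
  hom_inj := Subtype.val_injective
  map_le_one := A.valuation_le_one
  exists_of_le_one r hr := ⟨⟨r, A.mem_of_valuation_le_one r hr⟩, rfl⟩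

namespace Place

/-- Constants lie in every valuation ring: `𝔽_q ⊆ O_v` (nonzero constants are roots of unity,
hence have `ord_v = 0`). [folklore] -/
theorem algebraMap_mem (v : Place L) (c : Fq) : algebraMap Fq L c ∈ v.1 := by
  rcases eq_or_ne c 0 with rfl | hc
  · simp
  have hn : 0 < Fintype.card Fq - 1 := by
    have := Fintype.one_lt_card (α := Fq)
    omega
  have h1 : (algebraMap Fq L c) ^ (Fintype.card Fq - 1) = 1 := by
    rw [← map_pow, FiniteField.pow_card_sub_one_eq_one c hc, map_one]
  have h0 : algebraMap Fq L c ≠ 0 := (_root_.map_ne_zero _).2 hc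
  exact ((v.ord_eq_zero_iff h0).1 (v.ord_eq_zero_of_pow_eq_one hn h1)).1

/-- If `x ∈ O_v` then `𝔽_q[x] ⊆ O_v`. [folklore] -/
theorem mem_of_mem_adjoin (v : Place L) {x : L} (hx : x ∈ v.1) {y : L}
    (hy : y ∈ Algebra.adjoin Fq ({x} : Set L)) : y ∈ v.1 := by
  induction hy using Algebra.adjoin_induction with
  | mem z hz =>
    rw [Set.mem_singleton_iff] at hz
    subst hz
    exact hx
  | algebraMap c => exact v.algebraMap_mem c
  | add a b _ _ ha hb => exact add_mem ha hb
  | mul a b _ _ ha hb => exact mul_mem ha hb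

/-- If `x ∈ O_v` then the integral closure of `𝔽_q[x]` in `L` is contained in `O_v`
(valuation rings are integrally closed). [folklore] -/
theorem mem_of_mem_integralClosure (v : Place L) {x : L} (hx : x ∈ v.1) {s : L}
    (hs : s ∈ integralClosure (Algebra.adjoin Fq ({x} : Set L)) L) : s ∈ v.1 := by
  letI : Algebra (Algebra.adjoin Fq ({x} : Set L)) v.1 :=
    ((algebraMap (Algebra.adjoin Fq ({x} : Set L)) L).codRestrict v.1
      (fun y => v.mem_of_mem_adjoin hx y.2)).toAlgebra
  haveI : IsScalarTower (Algebra.adjoin Fq ({x} : Set L)) v.1 L :=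
    IsScalarTower.of_algebraMap_eq (fun _ => rfl)
  have hint : IsIntegral v.1 s := ((mem_integralClosure_iff _ _).1 hs).tower_top
  exact v.1.mem_of_valuation_le_one s
    ((valuationSubring_integers_self v.1).isIntegral_iff_v_le_one.1 hint)

/-- **Zeros of `x` counted with degree** (Rosen, Prop. 5.1, `deg (x)_0 = [L : 𝔽_q(x)]`, in the
separable case, via the fundamental identity Thm. 7.6 / Mathlib's `Ideal.sum_ramification_inertia`):
for `x` transcendental over `𝔽_q` with `L / 𝔽_q(x)` finite separable, the set of places with
`ord_v x > 0` is finite and `∑_{ord_v x > 0} ord_v(x) · deg v = [L : 𝔽_q(x)]`.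
[cite: RosenFunctionFields2002, Prop. 5.1 and Thm. 7.6] -/
theorem finite_zeros_and_finsum_eq_finrank (x : L) (hx : Transcendental Fq x)
    [FiniteDimensional Fq⟮x⟯ L] [Algebra.IsSeparable Fq⟮x⟯ L] :
    {v : Place L | 0 < v.ord x}.Finite ∧
      ∑ᶠ v ∈ {v : Place L | 0 < v.ord x}, v.ord x * (v.degree (Fintype.card Fq) : ℤ) =
        Module.finrank Fq⟮x⟯ L := by
  classical
  -- ### the chart `R = 𝔽_q[x] ⊆ K = 𝔽_q(x) ⊆ L`, `S` = integral closure of `R` in `L`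
  obtain ⟨e, hexR⟩ : ∃ e : Fq[X] ≃ₐ[Fq] Algebra.adjoin Fq {x},
      e X = ⟨x, Algebra.self_mem_adjoin_singleton Fq x⟩ :=
    ⟨_, Polynomial.algEquivOfTranscendental_apply_X Fq x hx⟩
  haveI : IsPrincipalIdealRing (Algebra.adjoin Fq {x}) :=
    IsPrincipalIdealRing.of_surjective e.toRingEquiv.toRingHom e.surjective
  haveI : IsDedekindDomain (Algebra.adjoin Fq {x}) := inferInstance
  haveI : IsFractionRing (integralClosure (Algebra.adjoin Fq {x}) L) L :=
    integralClosure.isFractionRing_of_finite_extension Fq⟮x⟯ L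
  haveI : IsDedekindDomain (integralClosure (Algebra.adjoin Fq {x}) L) :=
    integralClosure.isDedekindDomain (Algebra.adjoin Fq {x}) Fq⟮x⟯ L
  haveI : Module.Finite (Algebra.adjoin Fq {x}) (integralClosure (Algebra.adjoin Fq {x}) L) :=
    IsIntegralClosure.finite (Algebra.adjoin Fq {x}) Fq⟮x⟯ L
      (integralClosure (Algebra.adjoin Fq {x}) L)
  -- ### the prime `p = (x)` of `R`
  set xR : Algebra.adjoin Fq {x} := ⟨x, Algebra.self_mem_adjoin_singleton Fq x⟩ with hxR_def
  have hx0 : x ≠ 0 := fun h => hx (h ▸ isAlgebraic_zero)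
  have hxR0 : xR ≠ 0 := fun h => hx0 (congrArg Subtype.val h)
  have hprime : Prime xR := by rw [← hexR, MulEquiv.prime_iff e]; exact Polynomial.prime_X
  set p : Ideal (Algebra.adjoin Fq {x}) := Ideal.span {xR} with hp_def
  haveI hpP : p.IsPrime := (Ideal.span_singleton_prime hprime.ne_zero).2 hprime
  have hp0 : p ≠ ⊥ := by rwa [hp_def, Ne, Ideal.span_singleton_eq_bot]
  haveI : p.IsMaximal := IsPrime.to_maximal_ideal hp0
  have key := Ideal.sum_ramification_inertia (integralClosure (Algebra.adjoin Fq {x}) L)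
    Fq⟮x⟯ L hp0
  -- ### `R / p ≃ 𝔽_q`
  have hcard : Nat.card (Algebra.adjoin Fq {x} ⧸ p) = Fintype.card Fq := by
    have h1 : p = Ideal.map (e : Fq[X] →+* Algebra.adjoin Fq {x}) (Ideal.span {X}) := by
      rw [Ideal.map_span, Set.image_singleton, hp_def]
      exact congrArg (fun y => Ideal.span {y}) hexR.symm
    have h2 : Ideal.span {X - C (0 : Fq)} = Ideal.span {(X : Fq[X])} := by
      rw [map_zero, sub_zero]
    have e1 : (Fq[X] ⧸ Ideal.span {(X : Fq[X])}) ≃+* Algebra.adjoin Fq {x} ⧸ p :=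
      Ideal.quotientEquiv _ _ e.toRingEquiv h1
    have e2 : (Fq[X] ⧸ Ideal.span {X - C (0 : Fq)}) ≃ₐ[Fq] Fq :=
      Polynomial.quotientSpanXSubCAlgEquiv 0
    rw [← Nat.card_congr e1.toEquiv, ← Nat.card_eq_fintype_card, ← Nat.card_congr e2.toEquiv,
      Nat.card_congr (Ideal.quotEquivOfEq h2).toEquiv]
  -- ### zeros of `x` contain `S`
  have hzeros : ∀ v : Place L, 0 < v.ord x →
      ∀ s : integralClosure (Algebra.adjoin Fq {x}) L,
        algebraMap (integralClosure (Algebra.adjoin Fq {x}) L) L s ∈ v.1 := by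
    intro v hv s
    have hxv : x ∈ v.1 := (v.ord_nonneg_iff hx0).1 hv.le
    exact v.mem_of_mem_integralClosure hxv s.2
  have hxL : algebraMap (Algebra.adjoin Fq {x}) L xR = x := rfl
  obtain ⟨hfin, hsum⟩ := finite_zeros_and_finsum_eq_sum_ramification_inertia
    (S := integralClosure (Algebra.adjoin Fq {x}) L) (Fintype.one_lt_card (α := Fq)) p hp0 hcard
    hp_def hxL hzeros
  refine ⟨hfin, ?_⟩
  rw [hsum]
  exact_mod_cast key

end Place

end ZerosCount

end Literature.NumberTheory.EllipticCurves.FunctionField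

/-! ## Field theory: separating elements of one-variable function fields

Rosen Ch. 7 (Prop. 7.4: `[K : Kᵖ] = p`; Corollary and Prop. 7.5: purely inseparable descent) and
Stichtenoth Prop. III.10.2 (`z` is separating iff `z ∉ Fᵖ`), for a finitely generated extension
`F / k` of transcendence degree `1` over a perfect field `k` of characteristic `p`. -/

section FieldTheory

open scoped Classical Polynomial IntermediateField

open IntermediateField Polynomial

namespace Literature.NumberTheory.EllipticCurves.FunctionField

/-! ### `z ∉ k(zⁿ)` for transcendental `z` -/

section ClaimE

variable {k : Type*} [Field k] {F : Type*} [Field F] [Algebra k F]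

/-- A transcendental element `z` does not lie in `k(zⁿ)` for `n ≥ 2`: writing `z = r(zⁿ)/s(zⁿ)`
would give the identity `X · s(Xⁿ) = r(Xⁿ)` in `k[X]`, impossible by comparing degrees mod `n`.
[folklore] -/
theorem not_mem_adjoin_simple_pow {z : F} (hz : Transcendental k z) {n : ℕ} (hn : 1 < n) :
    z ∉ k⟮z ^ n⟯ := by
  intro hmem
  rw [mem_adjoin_simple_iff] at hmem
  obtain ⟨r, s, hrs⟩ := hmem
  have hinj := transcendental_iff_injective.1 hz
  have hexp : ∀ f : k[X], aeval (z ^ n) f = aeval z (expand k n f) := fun f => by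
    rw [expand_aeval]
  rw [hexp, hexp] at hrs
  by_cases hs : aeval z (expand k n s) = 0
  · rw [hs, div_zero] at hrs
    exact hz (hrs ▸ isAlgebraic_zero)
  have hs0 : s ≠ 0 := by
    rintro rfl
    simp at hs
  have hpoly : X * expand k n s = expand k n r := by
    apply hinj
    simp only [map_mul, aeval_X]
    exact (eq_div_iff hs).1 hrs
  have hdeg := congrArg natDegree hpoly
  rw [natDegree_X_mul ((expand_ne_zero (by omega)).2 hs0), natDegree_expand, natDegree_expand]
    at hdeg
  have h1 := congrArg (· % n) hdeg
  simp only [Nat.mul_add_mod_self_right, Nat.mul_mod_left] at h1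
  rw [Nat.one_mod_eq_one.2 hn.ne'] at h1
  exact one_ne_zero h1

end ClaimE

/-! ### `L = K(Lᵖ)` forces separability -/

section ClaimD

variable {K L : Type*} [Field K] [Field L] [Algebra K L] (p : ℕ) [ExpChar L p]

/-- If `L = K(Lᵖ)` then `L = K(L^{p^m})` for every `m`. [folklore] -/
theorem adjoin_range_iterateFrobenius_eq_top
    (h : adjoin K (Set.range (frobenius L p)) = ⊤) (m : ℕ) :
    adjoin K (Set.range (iterateFrobenius L p m)) = ⊤ := by
  induction m with
  | zero =>
    rw [iterateFrobenius_zero, eq_top_iff]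
    intro y _
    exact subset_adjoin K _ ⟨y, rfl⟩
  | succ m ih =>
    rw [eq_top_iff, ← ih, adjoin_le_iff]
    rintro _ ⟨y, rfl⟩
    have hy : y ∈ (adjoin K (Set.range (frobenius L p))).toSubfield := by
      rw [h]; trivial
    rw [adjoin_toSubfield] at hy
    have hmap : (Subfield.closure (Set.range (algebraMap K L) ∪ Set.range (frobenius L p))).map
        (iterateFrobenius L p m) ≤
        (adjoin K (Set.range (iterateFrobenius L p (m + 1)))).toSubfield := by
      rw [RingHom.map_field_closure, Subfield.closure_le]
      rintro _ ⟨w, hw, rfl⟩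
      rcases hw with ⟨c, rfl⟩ | ⟨u, rfl⟩
      · rw [iterateFrobenius_def, ← map_pow]
        exact (adjoin K _).algebraMap_mem _
      · rw [iterateFrobenius_def, frobenius_def, ← pow_mul, ← pow_succ']
        exact subset_adjoin K _ ⟨u, iterateFrobenius_def ..⟩
    exact hmap ⟨y, hy, rfl⟩

/-- **A finite extension `L / K` in characteristic `p` with `L = K(Lᵖ)` is separable**: by
induction `L = K(L^{p^m})` for all `m`, and `L^{p^m}` lies in the separable closure of `K` for
`m` the exponent of the purely inseparable extension `L / K^{sep}`.
[cite: Stichtenoth2009, Prop. III.10.2 (proof)] -/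
theorem isSeparable_of_adjoin_range_frobenius_eq_top [FiniteDimensional K L]
    (h : adjoin K (Set.range (frobenius L p)) = ⊤) : Algebra.IsSeparable K L := by
  haveI : IsPurelyInseparable (separableClosure K L) L :=
    separableClosure.isPurelyInseparable K L
  haveI : IsPurelyInseparable.HasExponent (separableClosure K L) L :=
    IsPurelyInseparable.hasExponent_of_finiteDimensional
  haveI : ExpChar (separableClosure K L) p :=
    RingHom.expChar (algebraMap (separableClosure K L) L)
      (algebraMap (separableClosure K L) L).injective p
  have hle : adjoin K (Set.range (iterateFrobenius L p
      (IsPurelyInseparable.exponent (separableClosure K L) L))) ≤ separableClosure K L := by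
    rw [adjoin_le_iff]
    rintro _ ⟨y, rfl⟩
    obtain ⟨s, hs⟩ := IsPurelyInseparable.exponent_def' (separableClosure K L) p y
    change y ^ p ^ _ ∈ separableClosure K L
    rw [← hs]
    exact s.2
  rw [adjoin_range_iterateFrobenius_eq_top p h, top_le_iff] at hle
  exact (separableClosure.eq_top_iff K L).1 hle

end ClaimD

/-! ### The subfield `Fᵖ` of a one-variable function field over a perfect field -/

section ClaimBC

variable (k : Type*) [Field k] [PerfectField k] {F : Type*} [Field F] [Algebra k F]
  (p : ℕ) [Fact p.Prime] [CharP F p]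

/-- Over a perfect field `k`, the constants lie in `Fᵖ`. [folklore] -/
theorem algebraMap_mem_fieldRange_frobenius (c : k) :
    algebraMap k F c ∈ (frobenius F p).fieldRange := by
  haveI : ExpChar k p := RingHom.expChar (algebraMap k F) (algebraMap k F).injective p
  refine RingHom.mem_fieldRange.2 ⟨algebraMap k F ((frobeniusEquiv k p).symm c), ?_⟩
  rw [frobenius_def, ← map_pow, frobeniusEquiv_symm_pow_p]

omit [PerfectField k] in
/-- `F / Fᵖ` is purely inseparable (of exponent one). [folklore] -/
theorem isPurelyInseparable_fieldRange_frobenius :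
    IsPurelyInseparable (frobenius F p).fieldRange F := by
  haveI : ExpChar (frobenius F p).fieldRange p :=
    RingHom.expChar (algebraMap (frobenius F p).fieldRange F)
      (algebraMap (frobenius F p).fieldRange F).injective p
  rw [isPurelyInseparable_iff_pow_mem _ p]
  intro y
  exact ⟨1, ⟨⟨y ^ p, RingHom.mem_fieldRange.2 ⟨y, rfl⟩⟩, by rw [pow_one]; rfl⟩⟩

omit [PerfectField k] in
/-- Every `t ∈ F` is integral over `Fᵖ`, a root of `X ^ p - t ^ p`. [folklore] -/
theorem natDegree_minpoly_fieldRange_frobenius_le (t : F) :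
    IsIntegral (frobenius F p).fieldRange t ∧
      (minpoly (frobenius F p).fieldRange t).natDegree ≤ p := by
  have hp : p.Prime := Fact.out
  set c : (frobenius F p).fieldRange := ⟨t ^ p, RingHom.mem_fieldRange.2 ⟨t, rfl⟩⟩ with hc
  have hP0 : (X ^ p - C c : (frobenius F p).fieldRange[X]) ≠ 0 := X_pow_sub_C_ne_zero hp.pos c
  have hPt : aeval t (X ^ p - C c : (frobenius F p).fieldRange[X]) = 0 := by
    simp only [map_sub, map_pow, aeval_X, aeval_C]
    exact sub_self _
  have hint : IsIntegral (frobenius F p).fieldRange t :=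
    ⟨X ^ p - C c, monic_X_pow_sub_C c hp.ne_zero, by simpa [aeval_def] using hPt⟩
  refine ⟨hint, ?_⟩
  have h := minpoly.degree_le_of_ne_zero (frobenius F p).fieldRange t hP0 hPt
  exact (natDegree_le_natDegree h).trans (by rw [natDegree_X_pow_sub_C])

/-- **`[F : Fᵖ] ≤ p`** for a finitely generated extension `F / k` of transcendence degree `1`
over a perfect field `k` of characteristic `p` (and `F / Fᵖ` is finite). Proof: by Mathlib's
`exists_isTranscendenceBasis_and_isSeparable_of_perfectField` there is a separating element `t`
(`F / k(t)` separable); then `F / Fᵖ(t)` is separable and purely inseparable, so `F = Fᵖ(t)`,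
of degree `≤ p` since `t` is a root of `X ^ p - t ^ p ∈ Fᵖ[X]`.
[cite: RosenFunctionFields2002, Prop. 7.4 (`[K : Kᵖ] = p`); Stichtenoth2009,
Prop. III.10.2 (c)] -/
theorem finrank_fieldRange_frobenius_le [Algebra.EssFiniteType k F] (h1 : Algebra.trdeg k F = 1) :
    FiniteDimensional (frobenius F p).fieldRange F ∧
      Module.finrank (frobenius F p).fieldRange F ≤ p := by
  obtain ⟨s, hs, hsep⟩ := exists_isTranscendenceBasis_and_isSeparable_of_perfectField k F
  have hcard : s.card = 1 := by
    have := hs.cardinalMk_eq_trdeg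
    rw [h1, Cardinal.mk_coe_finset, Nat.cast_eq_one] at this
    exact this
  obtain ⟨t, rfl⟩ := Finset.card_eq_one.1 hcard
  rw [Finset.coe_singleton] at hsep
  set Fp := (frobenius F p).fieldRange with hFp
  set M : IntermediateField Fp F := Fp⟮t⟯ with hM_def
  have hle : k⟮t⟯.toSubfield ≤ M.toSubfield := by
    rw [adjoin_toSubfield, Subfield.closure_le]
    rintro y (⟨c, rfl⟩ | hy)
    · exact M.algebraMap_mem ⟨_, algebraMap_mem_fieldRange_frobenius k p c⟩
    · rw [Set.mem_singleton_iff] at hy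
      subst hy
      exact mem_adjoin_simple_self Fp y
  letI : Algebra k⟮t⟯ M := (Subfield.inclusion hle).toAlgebra
  haveI : IsScalarTower k⟮t⟯ M F := IsScalarTower.of_algebraMap_eq (fun _ => rfl)
  haveI : Algebra.IsSeparable M F := Algebra.isSeparable_tower_top_of_isSeparable k⟮t⟯ M F
  haveI : IsPurelyInseparable Fp F := isPurelyInseparable_fieldRange_frobenius (F := F) p
  haveI : IsPurelyInseparable M F := IsPurelyInseparable.tower_top Fp M F
  have hM : M = ⊤ := by
    rw [eq_top_iff]
    intro y _
    obtain ⟨m, hm⟩ := IsPurelyInseparable.surjective_algebraMap_of_isSeparable M F y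
    rw [← hm]
    exact m.2
  obtain ⟨hint, hdeg⟩ := natDegree_minpoly_fieldRange_frobenius_le (F := F) p t
  have hfin : FiniteDimensional Fp M := adjoin.finiteDimensional hint
  have hrank : Module.finrank Fp M ≤ p := by
    rw [hM_def, adjoin.finrank hint]
    exact hdeg
  rw [hM] at hfin hrank
  haveI : FiniteDimensional Fp F :=
    LinearEquiv.finiteDimensional (IntermediateField.topEquiv (F := Fp) (E := F)).toLinearEquiv
  exact ⟨this, by rwa [IntermediateField.finrank_top'] at hrank⟩

omit [PerfectField k] in
/-- If `x ∉ Fᵖ` then `[Fᵖ(x) : Fᵖ] = p`: the minimal polynomial of `x` over `Fᵖ` is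
`X ^ (p ^ n) - c` (purely inseparable) and divides `X ^ p - x ^ p`. [folklore] -/
theorem finrank_fieldRange_frobenius_adjoin_simple {x : F} (hx : x ∉ (frobenius F p).fieldRange) :
    IsIntegral (frobenius F p).fieldRange x ∧
      Module.finrank (frobenius F p).fieldRange (frobenius F p).fieldRange⟮x⟯ = p := by
  have hp : p.Prime := Fact.out
  set Fp := (frobenius F p).fieldRange with hFp
  haveI : ExpChar Fp p := RingHom.expChar (algebraMap Fp F) (algebraMap Fp F).injective p
  haveI : IsPurelyInseparable Fp F := isPurelyInseparable_fieldRange_frobenius (F := F) p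
  obtain ⟨hint, hdeg⟩ := natDegree_minpoly_fieldRange_frobenius_le (F := F) p x
  obtain ⟨n, y, hmin⟩ := IsPurelyInseparable.minpoly_eq_X_pow_sub_C Fp p x
  refine ⟨hint, ?_⟩
  rw [adjoin.finrank hint, hmin, natDegree_X_pow_sub_C]
  rw [hmin, natDegree_X_pow_sub_C] at hdeg
  have hn0 : n ≠ 0 := by
    rintro rfl
    apply hx
    rw [pow_zero, pow_one] at hmin
    have h0 := minpoly.aeval Fp x
    rw [hmin] at h0
    simp only [map_sub, aeval_X, aeval_C, sub_eq_zero] at h0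
    rw [h0]
    exact y.2
  have hn1 : n ≤ 1 := by
    have : p ^ n ≤ p ^ 1 := by rwa [pow_one]
    exact (Nat.pow_le_pow_iff_right hp.one_lt).1 this
  obtain rfl : n = 1 := by omega
  rw [pow_one]

/-- **`x ∉ Fᵖ ⇒ F / k(x)` is separable** (for `F / k` finitely generated of transcendence
degree `1` over a perfect field `k`, and `[F : k(x)] < ∞`): from `[F : Fᵖ] ≤ p = [Fᵖ(x) : Fᵖ]`
we get `F = Fᵖ(x) = k(x)(Fᵖ)`, and `isSeparable_of_adjoin_range_frobenius_eq_top` applies.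
[cite: Stichtenoth2009, Prop. III.10.2 (d)] -/
theorem isSeparable_adjoin_simple_of_not_mem [Algebra.EssFiniteType k F]
    (h1 : Algebra.trdeg k F = 1) {x : F} (hx : x ∉ (frobenius F p).fieldRange)
    [FiniteDimensional k⟮x⟯ F] : Algebra.IsSeparable k⟮x⟯ F := by
  set Fp := (frobenius F p).fieldRange with hFp
  obtain ⟨hfinFp, hle⟩ := finrank_fieldRange_frobenius_le k p (F := F) h1
  obtain ⟨-, hrank⟩ := finrank_fieldRange_frobenius_adjoin_simple (F := F) p hx
  have htop : Fp⟮x⟯ = ⊤ :=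
    IntermediateField.eq_of_le_of_finrank_le le_top
      (by rw [IntermediateField.finrank_top', hrank]; exact hle)
  apply isSeparable_of_adjoin_range_frobenius_eq_top p
  rw [eq_top_iff]
  intro y _
  have hy : y ∈ (Fp⟮x⟯).toSubfield := by rw [htop]; trivial
  rw [adjoin_toSubfield] at hy
  refine Subfield.closure_le.2 ?_ hy
  rintro w (⟨c, rfl⟩ | hw)
  · exact subset_adjoin _ _ (RingHom.mem_fieldRange.1 c.2)
  · rw [Set.mem_singleton_iff] at hw
    subst hw
    exact (adjoin k⟮w⟯ _).algebraMap_mem ⟨w, mem_adjoin_simple_self k w⟩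

end ClaimBC

/-! ### Finiteness of `[F : k(x)]` and `p`-power descent to a separating element -/

section Descent

universe u_1 u_2

variable (k : Type u_1) [Field k] {F : Type u_2} [Field F] [Algebra k F]

/-- In a finitely generated extension `F / k` of transcendence degree `1`, `[F : k(x)] < ∞` for
every transcendental `x` (`{x}` is a transcendence basis, so `F / k(x)` is algebraic and finitely
generated). [cite: RosenFunctionFields2002, Ch. 5, p. 49 ("K/F(y) is a finite extension")] -/
theorem finiteDimensional_adjoin_simple_of_transcendental [Algebra.EssFiniteType k F]
    (h1 : Algebra.trdeg k F = 1) {x : F} (hx : Transcendental k x) :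
    FiniteDimensional k⟮x⟯ F := by
  have hind : AlgebraicIndependent k (fun _ : PUnit.{u_2 + 1} => x) :=
    algebraicIndependent_unique_type_iff.2 hx
  have hb : IsTranscendenceBasis k (fun _ : PUnit.{u_2 + 1} => x) :=
    hind.isTranscendenceBasis_of_trdeg_le_of_finite (h1.le.trans (Cardinal.mk_eq_one PUnit).ge)
  haveI : Algebra.IsAlgebraic k⟮x⟯ F := by
    have := hb.isAlgebraic_field
    rwa [Set.range_const] at this
  haveI : Algebra.EssFiniteType k⟮x⟯ F := Algebra.EssFiniteType.of_comp k k⟮x⟯ F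
  exact Algebra.finite_of_essFiniteType_of_isAlgebraic

variable [PerfectField k] (p : ℕ) [Fact p.Prime] [CharP F p]

/-- **Descent to a separating element.** In a finitely generated extension `F / k` of
transcendence degree `1` over a perfect field `k` of characteristic `p`, every transcendental `x`
is `y ^ (p ^ e)` for some `y` with `F / k(y)` separable: if `x ∉ Fᵖ` take `y = x`
(`isSeparable_adjoin_simple_of_not_mem`), otherwise `x = zᵖ` with `[F : k(z)] < [F : k(x)]`
(`not_mem_adjoin_simple_pow`) and induct.
[cite: Stichtenoth2009, Prop. III.10.2 (c), (d); RosenFunctionFields2002, Prop. 7.4, Corollary,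
and Prop. 7.5 (proof)] -/
theorem exists_pow_eq_and_isSeparable [Algebra.EssFiniteType k F] (h1 : Algebra.trdeg k F = 1)
    {x : F} (hx : Transcendental k x) :
    ∃ (y : F) (e : ℕ), y ^ p ^ e = x ∧ Transcendental k y ∧ Algebra.IsSeparable k⟮y⟯ F := by
  have hp : p.Prime := Fact.out
  suffices H : ∀ (n : ℕ) (x : F), Transcendental k x → Module.finrank k⟮x⟯ F = n →
      ∃ (y : F) (e : ℕ), y ^ p ^ e = x ∧ Transcendental k y ∧ Algebra.IsSeparable k⟮y⟯ F from
    H _ x hx rfl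
  intro n
  induction n using Nat.strong_induction_on with
  | _ n ih =>
    intro x hx hn
    haveI := finiteDimensional_adjoin_simple_of_transcendental k h1 hx
    by_cases hmem : x ∈ (frobenius F p).fieldRange
    · obtain ⟨z, rfl⟩ := RingHom.mem_fieldRange.1 hmem
      have hz : Transcendental k z := fun h => hx (by rw [frobenius_def]; exact h.pow p)
      haveI := finiteDimensional_adjoin_simple_of_transcendental k h1 hz
      have hle : k⟮frobenius F p z⟯ ≤ k⟮z⟯ :=
        adjoin_simple_le_iff.2 (by rw [frobenius_def]; exact pow_mem (mem_adjoin_simple_self k z) p)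
      have hlt : Module.finrank k⟮z⟯ F < Module.finrank k⟮frobenius F p z⟯ F := by
        by_contra hge
        push Not at hge
        have heq := eq_of_le_of_finrank_le' hle hge
        apply not_mem_adjoin_simple_pow hz hp.one_lt
        rw [← frobenius_def, heq]
        exact mem_adjoin_simple_self k z
      obtain ⟨y, e, hy, hyt, hsep⟩ := ih _ (hn ▸ hlt) z hz rfl
      exact ⟨y, e + 1, by rw [pow_succ, pow_mul, hy, frobenius_def], hyt, hsep⟩
    · exact ⟨x, 0, by simp, hx, isSeparable_adjoin_simple_of_not_mem k p h1 hmem⟩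

end Descent

/-! ### The interface to `FunctionField Fq F`: `EssFiniteType` and transcendence degree `1` -/

section RatFuncInterface

variable (Fq F : Type) [Field Fq] [Field F] [Algebra Fq F] [Algebra (RatFunc Fq) F]
  [IsScalarTower Fq (RatFunc Fq) F] [FiniteDimensional (RatFunc Fq) F]

/-- A finite extension of `Fq(X)` is essentially of finite type over `Fq`. [folklore] -/
theorem essFiniteType_of_ratFunc : Algebra.EssFiniteType Fq F := by
  haveI : Algebra.EssFiniteType Fq[X] (RatFunc Fq) :=
    Algebra.EssFiniteType.of_isLocalization (RatFunc Fq) (nonZeroDivisors Fq[X])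
  haveI : Algebra.EssFiniteType Fq (RatFunc Fq) := Algebra.EssFiniteType.comp Fq Fq[X] (RatFunc Fq)
  haveI : Algebra.EssFiniteType (RatFunc Fq) F := inferInstance
  exact Algebra.EssFiniteType.comp Fq (RatFunc Fq) F

/-- A finite extension of `Fq(X)` has transcendence degree `1` over `Fq`. [folklore] -/
theorem trdeg_eq_one_of_ratFunc : Algebra.trdeg Fq F = 1 := by
  haveI : Algebra.IsAlgebraic Fq[X] (RatFunc Fq) :=
    IsLocalization.isAlgebraic (RatFunc Fq) (nonZeroDivisors Fq[X])
  have h1 := lift_trdeg_add_eq Fq (RatFunc Fq) F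
  have h2 := lift_trdeg_add_eq Fq Fq[X] (RatFunc Fq)
  rw [trdeg_eq_zero (R := RatFunc Fq) (A := F)] at h1
  rw [trdeg_eq_zero (R := Fq[X]) (A := RatFunc Fq), Polynomial.trdeg_of_isDomain] at h2
  simp only [Cardinal.lift_id, add_zero] at h1 h2
  rw [← h1, ← h2]

end RatFuncInterface

end Literature.NumberTheory.EllipticCurves.FunctionField


end FieldTheory

/-! ### Assembly: principal divisors have degree zero

For `y` transcendental over `𝔽_q` with `F / 𝔽_q(y)` finite separable, the zeros of `y` count
`[F : 𝔽_q(y)]` and so do the poles (the zeros of `y⁻¹`, as `𝔽_q(y⁻¹) = 𝔽_q(y)`), so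
`∑_v ord_v(y) deg v = 0`. A general transcendental `x` is `y ^ (p ^ e)` with such a `y`
(`exists_pow_eq_and_isSeparable`), and `ord_v (y ^ n) = n · ord_v y`. A nonzero algebraic `x` is a
root of unity, so all `ord_v x = 0`. -/

namespace Literature.NumberTheory.EllipticCurves.FunctionField

section Assembly

open IntermediateField

variable {Fq : Type} [Field Fq] {F : Type} [Field F] [Algebra Fq F]

namespace Place

/-- `𝔽_q(y⁻¹) = 𝔽_q(y)`. [folklore] -/
theorem adjoin_simple_inv_eq (y : F) : Fq⟮y⁻¹⟯ = Fq⟮y⟯ := by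
  refine le_antisymm (adjoin_simple_le_iff.2 (inv_mem (mem_adjoin_simple_self Fq y)))
    (adjoin_simple_le_iff.2 ?_)
  have := inv_mem (mem_adjoin_simple_self Fq y⁻¹)
  rwa [inv_inv] at this

variable [Fintype Fq]

/-- **Product formula, separable chart.** For `y` transcendental over `𝔽_q` with `F / 𝔽_q(y)`
finite separable, `∑_v ord_v(y) · deg v = 0`: the zeros count `[F : 𝔽_q(y)]`
(`finite_zeros_and_finsum_eq_finrank` for `y`) and so do the poles (the same for `y⁻¹`).
[cite: RosenFunctionFields2002, Prop. 5.1] -/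
theorem finsum_ord_mul_degree_eq_zero_of_isSeparable (y : F) (hy : Transcendental Fq y)
    [FiniteDimensional Fq⟮y⟯ F] [Algebra.IsSeparable Fq⟮y⟯ F] :
    ∑ᶠ v : Place F, v.ord y * (v.degree (Fintype.card Fq) : ℤ) = 0 := by
  classical
  have hyi : Transcendental Fq y⁻¹ := fun h => hy (by simpa using h.inv)
  have heq : Fq⟮y⁻¹⟯ = Fq⟮y⟯ := adjoin_simple_inv_eq y
  haveI : FiniteDimensional Fq⟮y⁻¹⟯ F := by rw [heq]; infer_instance
  haveI : Algebra.IsSeparable Fq⟮y⁻¹⟯ F := by rw [heq]; infer_instance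
  obtain ⟨hfinZ, hsumZ⟩ := finite_zeros_and_finsum_eq_finrank (Fq := Fq) y hy
  obtain ⟨hfinP, hsumP⟩ := finite_zeros_and_finsum_eq_finrank (Fq := Fq) y⁻¹ hyi
  have hrank : Module.finrank Fq⟮y⁻¹⟯ F = Module.finrank Fq⟮y⟯ F := by rw [heq]
  rw [hrank, ← hsumZ] at hsumP
  simp only [ord_inv] at hfinP hsumP
  rw [finsum_mem_eq_finite_toFinset_sum _ hfinZ, finsum_mem_eq_finite_toFinset_sum _ hfinP] at hsumP
  have hsupp : (Function.support fun v : Place F => v.ord y * (v.degree (Fintype.card Fq) : ℤ)) ⊆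
      ↑(hfinZ.toFinset ∪ hfinP.toFinset) := by
    intro v hv
    rw [Function.mem_support] at hv
    have h : v.ord y ≠ 0 := fun h => hv (by rw [h, zero_mul])
    simp only [Finset.coe_union, Set.Finite.coe_toFinset, Set.mem_union, Set.mem_setOf_eq]
    omega
  rw [finsum_eq_sum_of_support_subset _ hsupp, Finset.sum_union]
  · have : ∑ v ∈ hfinP.toFinset, v.ord y * (v.degree (Fintype.card Fq) : ℤ) =
        -∑ v ∈ hfinP.toFinset, -v.ord y * (v.degree (Fintype.card Fq) : ℤ) := by
      rw [← Finset.sum_neg_distrib]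
      exact Finset.sum_congr rfl fun v _ => by ring
    rw [this, hsumP, add_neg_cancel]
  · rw [Finset.disjoint_left]
    intro v hvZ hvP
    simp only [Set.Finite.mem_toFinset, Set.mem_setOf_eq] at hvZ hvP
    omega

/-- **Product formula for nonzero constants**: an `x ≠ 0` algebraic over `𝔽_q` is a root of
unity, so `ord_v x = 0` for all `v`. [cite: RosenFunctionFields2002, Prop. 5.1] -/
theorem finsum_ord_mul_degree_eq_zero_of_isAlgebraic {x : F} (hx : IsAlgebraic Fq x) (hx0 : x ≠ 0)
    (q : ℕ) : ∑ᶠ v : Place F, v.ord x * (v.degree q : ℤ) = 0 := by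
  haveI : FiniteDimensional Fq Fq⟮x⟯ := adjoin.finiteDimensional hx.isIntegral
  haveI : Finite Fq⟮x⟯ := Module.finite_of_finite Fq
  letI : Fintype Fq⟮x⟯ := Fintype.ofFinite _
  set x' : Fq⟮x⟯ := ⟨x, mem_adjoin_simple_self Fq x⟩ with hx'_def
  have hx' : x' ≠ 0 := fun h => hx0 (congrArg Subtype.val h)
  have hpow : x ^ (Fintype.card Fq⟮x⟯ - 1) = 1 := by
    have h := congrArg Subtype.val (FiniteField.pow_card_sub_one_eq_one x' hx')
    simpa using h
  have hn : 0 < Fintype.card Fq⟮x⟯ - 1 := by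
    have := Fintype.one_lt_card (α := Fq⟮x⟯)
    omega
  apply finsum_eq_zero_of_forall_eq_zero
  intro v
  rw [v.ord_eq_zero_of_pow_eq_one hn hpow, zero_mul]

/-- **Product formula, transcendental case** (for `F / 𝔽_q` finitely generated of transcendence
degree `1`): write `x = y ^ (p ^ e)` with `F / 𝔽_q(y)` separable (`exists_pow_eq_and_isSeparable`)
and use `ord_v (yⁿ) = n · ord_v y`. [cite: RosenFunctionFields2002, Prop. 5.1] -/
theorem finsum_ord_mul_degree_eq_zero_of_transcendental (p : ℕ) [Fact p.Prime] [CharP F p]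
    [Algebra.EssFiniteType Fq F] (h1 : Algebra.trdeg Fq F = 1) {x : F}
    (hx : Transcendental Fq x) :
    ∑ᶠ v : Place F, v.ord x * (v.degree (Fintype.card Fq) : ℤ) = 0 := by
  obtain ⟨y, e, rfl, hyt, hsep⟩ := exists_pow_eq_and_isSeparable Fq p h1 hx
  haveI := finiteDimensional_adjoin_simple_of_transcendental Fq h1 hyt
  have h0 := finsum_ord_mul_degree_eq_zero_of_isSeparable y hyt
  simp only [ord_pow, mul_assoc]
  rw [← mul_finsum, h0, mul_zero]

/-- The product formula for `F / 𝔽_q` finitely generated of transcendence degree `1`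
(`x` transcendental or a nonzero constant). [cite: RosenFunctionFields2002, Prop. 5.1] -/
theorem finsum_ord_mul_degree_eq_zero_aux (p : ℕ) [Fact p.Prime] [CharP F p]
    [Algebra.EssFiniteType Fq F] (h1 : Algebra.trdeg Fq F = 1) (x : F) (hx0 : x ≠ 0) :
    ∑ᶠ v : Place F, v.ord x * (v.degree (Fintype.card Fq) : ℤ) = 0 := by
  by_cases hx : Transcendental Fq x
  · exact finsum_ord_mul_degree_eq_zero_of_transcendental p h1 hx
  · exact finsum_ord_mul_degree_eq_zero_of_isAlgebraic (not_not.1 hx) hx0 _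

end Place

end Assembly

section Main

open scoped Polynomial

variable (Fq F : Type) [Field Fq] [Fintype Fq] [Field F] [Algebra Fq[X] F]
  [Algebra (RatFunc Fq) F] [IsScalarTower Fq[X] (RatFunc Fq) F] [FunctionField Fq F]

/-- **Discharge** of `finsum_ord_mul_degree_eq_zero` (**Rosen, Prop. 5.1**: the degree of a
principal divisor is zero, `∑_v ord_v(x) · deg v = 0` for `x ≠ 0` in a global function field
`F / 𝔽_q(T)`). The constant field `𝔽_q` acts through `𝔽_q[T] → F`; the proof reduces to
`Place.finsum_ord_mul_degree_eq_zero_aux` (`F / 𝔽_q` is finitely generated of transcendence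
degree `1`). No exact-constant-field hypothesis is needed: `deg v` is taken over `𝔽_q`.
[cite: RosenFunctionFields2002, Prop. 5.1; Stichtenoth2009, Thm. I.4.11] -/
theorem finsum_ord_mul_degree_eq_zero_holds : finsum_ord_mul_degree_eq_zero Fq F := by
  intro x hx
  letI : Algebra Fq F := ((algebraMap Fq[X] F).comp Polynomial.C).toAlgebra
  haveI : IsScalarTower Fq (RatFunc Fq) F := IsScalarTower.of_algebraMap_eq fun c => by
    rw [IsScalarTower.algebraMap_apply Fq Fq[X] (RatFunc Fq) c, Polynomial.algebraMap_eq,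
      ← IsScalarTower.algebraMap_apply Fq[X] (RatFunc Fq) F (Polynomial.C c)]
    rfl
  haveI : Algebra.EssFiniteType Fq F := essFiniteType_of_ratFunc Fq F
  have h1 : Algebra.trdeg Fq F = 1 := trdeg_eq_one_of_ratFunc Fq F
  obtain ⟨p, hchar⟩ := CharP.exists Fq
  have hp : p.Prime := CharP.char_is_prime Fq p
  haveI : Fact p.Prime := ⟨hp⟩
  haveI : CharP F p := charP_of_injective_algebraMap (algebraMap Fq F).injective p
  exact Place.finsum_ord_mul_degree_eq_zero_aux p h1 x hx

end Main

end Literature.NumberTheory.EllipticCurves.FunctionField
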